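import Mathlib.Analysis.Calculus.Deriv.MeanValue
import Mathlib.Analysis.Calculus.Deriv.Polynomial
import Mathlib.Analysis.SpecialFunctions.ExpDeriv
import Mathlib.Algebra.Group.ForwardDiff
import Mathlib.LinearAlgebra.Vandermonde
import Mathlib.LinearAlgebra.Matrix.Block
import Mathlib.Topology.Instances.Matrix
import Mathlib.Analysis.Asymptotics.Lemmas
import Mathlib.Analysis.SpecialFunctions.Log.Basic
import HarnessLib

/-!
# Eventual positivity of consecutive Toeplitz minors of a sequence with a Hermite-type profile

Trunk T-ANALYSIS (Literature/Analysis/TotalPositivity). Leaf E1 of the decomposition of the named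
fact `Literature.NumberTheory.LFunctions.katkova_apf` (Katkova 2006, Thm. 2: `ξ₁ ∈ APF_m`; see
`Literature/NumberTheory/LFunctions/XiMultiplePositivity.lean`): the analytic input of Katkova's
Thm. 2 is her Prop. 1 [Katkova2006, §2], the positivity of the CONSECUTIVE Toeplitz minors
`A_k^ν = det (a_{k+j-l})_{l,j<ν}` of the Taylor sequence of `ξ₁` for `k ≥ N(ν)`. Katkova proves it
by a saddle-point analysis of `ν`-fold integrals (§§2–4). Here we prove a general real-variable
substitute, in the spirit of Griffin–Ono–Rolen–Zagier [GORZPNAS2019, Thm. 3 and §5.1 eq. (15)]: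

> **Theorem** (`ToeplitzAsymp.det_toeplitz_eventually_pos`). Let `a_n > 0` and suppose that for
> some `D ≥ 2ν - 2` there are `A(n)`, `δ(n) → 0⁺` and `gᵢ(n) = o(δ(n)ⁱ)` (`3 ≤ i ≤ D`) with
> `log(a_{n+j}/a_n) = A(n) j - δ(n)² j² + ∑_{i=3}^{D} gᵢ(n) jⁱ + o(δ(n)^D)` for `0 ≤ j ≤ D`
> (the shape of GORZ's eq. (15)). Then `det (a_{k+j-l})_{l,j<ν} > 0` for all large `k`.

For `a_n = γ(n)/n!` (`γ = Literature.xiTaylorCoeff`) the hypothesis is supplied by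
`Literature/NumberTheory/LFunctions/JensenAsymptoticsFactorial.lean` (from the tree's proof of
(15) for `γ`, `Literature.NumberTheory.LFunctions.xiTaylorCoeff_logRatio_holds`), which yields Katkova's consecutive-minor
statement `Literature.NumberTheory.LFunctions.katkova_consecutive_minors_pos` and, through Fekete's criterion
(`FeketeCriterion.lean`), `Literature.NumberTheory.LFunctions.katkova_apf` (`XiMultiplePositivityProofs.lean`).

## The proof

Put `n = k - (ν-1)`. Reversing the rows turns `(a_{k+j-l})` into the Hankel matrix
`(a_{n+l+j})`, and `a_{n+s} = a_n e^{A s} F̂(s)` with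
`F̂(s) = exp(-δ²s² + ∑ gᵢ sⁱ + ε(s))`, `ε(s) = o(δ^D)`; the factors `a_n e^{Al}`, `e^{Aj}` leave
the sign of the determinant unchanged. Row and column difference operations (the unitriangular
matrix `diffLower` of signed binomial coefficients) give
`det (F̂(l+j)) = det (Δ^{l+j} F̂(0)) = δ^{2e} det N`, `e = ∑_{i<ν} i`,
`N_{lj} = δ^{-(l+j)} Δ^{l+j} F̂(0)` (`det_hankel_eq_det_fwdDiff`, `det_of_pow_add_mul`). Now
`F̂ = F·e^{ε}` with `F(s) = G(δ s)`, `G = exp ∘ Φ_c`, `Φ_c(t) = -t² + ∑ cᵢ tⁱ`, `cᵢ = gᵢ/δⁱ → 0`,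
and `δ^{-m} Δ_δ^m G(0) = G^{(m)}(ξ)` for some `ξ ∈ [0, mδ]` (mean value theorem for iterated
differences, `exists_fwdDiff_iter_eq`, with `G^{(m)} = Q_m(c) e^{Φ_c}` for explicit polynomials
`Q_m`); as `n → ∞` this tends to the constant `H_m = Q_m(0)(0)` (continuity of the coefficients
of `Q_m(c)` in `c`, `tendsto_fwdDiff_iter_div_pow`), and the `ε`-part contributes
`o(δ^{D-m}) → 0`. Hence `N → (H_{l+j})` and the same holds for the Gaussian comparison sequence
`F⁰(s) = e^{-δ²s²}` (`c = 0`, `ε = 0`), so `det N - det N⁰ → 0`. Finally the Gaussian matrix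
`(e^{-δ²(y_j - l)²})`, `y_j = j + ν - 1`, is a positive Vandermonde-type determinant
`≥ e^{-5ν³} (2δ²)^e` (`det_gauss_eq`, `gauss_det_lower_bound`), which forces the sign of
`det N⁰`, hence of `det N`, hence of the original minor, to be positive.

## References

* O. M. Katkova, *Multiple positivity and the Riemann zeta-function*, Comput. Methods Funct.
  Theory 7 (2007) 13–31; arXiv:math/0505174, §2, Prop. 1. [Katkova2006]
* M. Griffin, K. Ono, L. Rolen, D. Zagier, *Jensen polynomials for the Riemann zeta function and
  other sequences*, PNAS 116 (2019) 11103–11110, Thm. 3 and §5.1 eq. (15). [GORZPNAS2019]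
* S. Karlin, *Total Positivity I*, Stanford UP 1968, Ch. 3 (total positivity of the Gaussian
  kernel). [Karlin1968]
-/

noncomputable section

open Filter Topology Asymptotics Finset Polynomial fwdDiff Matrix

namespace Literature.Analysis.TotalPositivity

namespace ToeplitzAsymp

/-! ### Mean value theorem for iterated forward differences -/

/-- If `G (m+1)` is the derivative of `G m` for every `m`, then the `m`-th forward difference of
`G 0` with step `h > 0` at `x` is `h ^ m * G m ξ` for some `ξ ∈ [x, x + m h]`. [folklore] -/
theorem exists_fwdDiff_iter_eq (G : ℕ → ℝ → ℝ) (hG : ∀ m x, HasDerivAt (G m) (G (m + 1) x) x)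
    {h : ℝ} (hh : 0 < h) (m : ℕ) (x : ℝ) :
    ∃ ξ ∈ Set.Icc x (x + m * h), Δ_[h]^[m] (G 0) x = h ^ m * G m ξ := by
  induction m generalizing G x with
  | zero => exact ⟨x, by simp, by simp⟩
  | succ m ih =>
    -- the shifted family
    set G' : ℕ → ℝ → ℝ := fun m y => G m (y + h) - G m y with hG'
    have hG'd : ∀ m x, HasDerivAt (G' m) (G' (m + 1) x) x := by
      intro m x
      simp only [hG']
      have h1 : HasDerivAt (fun y => G m (y + h)) (G (m + 1) (x + h)) x :=
        HasDerivAt.comp_add_const x h (hG m (x + h))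
      exact h1.sub (hG m x)
    obtain ⟨ξ₁, hξ₁, e1⟩ := ih G' hG'd x
    -- mean value theorem for `G m` on `[ξ₁, ξ₁ + h]`
    obtain ⟨c, hc, e2⟩ := exists_hasDerivAt_eq_slope (G m) (G (m + 1)) (by linarith)
      (fun y _ => (hG m y).continuousAt.continuousWithinAt) (fun y _ => hG m y)
      (a := ξ₁) (b := ξ₁ + h)
    refine ⟨c, ⟨?_, ?_⟩, ?_⟩
    · exact hξ₁.1.trans hc.1.le
    · have := hξ₁.2
      push_cast
      nlinarith [hc.2]
    · rw [Function.iterate_succ_apply, show fwdDiff h (G 0) = G' 0 from rfl, e1, pow_succ]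
      simp only [hG'] at e2 ⊢
      rw [add_sub_cancel_left] at e2
      rw [eq_div_iff hh.ne'] at e2
      rw [mul_assoc, ← e2]
      ring

/-! ### The functions `G_m(c; t) = Q_m(c)(t) · exp(Φ_c(t))` -/

variable (D : ℕ)

/-- `Φ_c(t) = -t² + ∑_{3 ≤ i ≤ D} cᵢ tⁱ`. [folklore] -/
def Φ (c : ℕ → ℝ) : ℝ[X] := -X ^ 2 + ∑ i ∈ Icc 3 D, C (c i) * X ^ i

/-- `Q_0 = 1`, `Q_{m+1} = Q_m' + Φ_c' Q_m`, so that `(exp Φ_c)^{(m)} = Q_m exp Φ_c`. [folklore] -/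
def Q (c : ℕ → ℝ) : ℕ → ℝ[X]
  | 0 => 1
  | m + 1 => derivative (Q c m) + derivative (Φ D c) * Q c m

/-- `Q_0 = 1`. [folklore] -/
@[simp] theorem Q_zero (c : ℕ → ℝ) : Q D c 0 = 1 := rfl

/-- The recursion `Q_{m+1} = Q_m' + Φ_c' Q_m`. [folklore] -/
theorem Q_succ (c : ℕ → ℝ) (m : ℕ) :
    Q D c (m + 1) = derivative (Q D c m) + derivative (Φ D c) * Q D c m := rfl

/-- `G_m(c; t) = Q_m(c)(t) exp(Φ_c(t))`, the `m`-th `t`-derivative of `exp Φ_c`. [folklore] -/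
def G (c : ℕ → ℝ) (m : ℕ) (t : ℝ) : ℝ := (Q D c m).eval t * Real.exp ((Φ D c).eval t)

/-- `d/dt G_m(c; t) = G_{m+1}(c; t)`. [folklore] -/
theorem hasDerivAt_G (c : ℕ → ℝ) (m : ℕ) (t : ℝ) :
    HasDerivAt (G D c m) (G D c (m + 1) t) t := by
  have h1 := (Q D c m).hasDerivAt t
  have h2 : HasDerivAt (fun t => Real.exp ((Φ D c).eval t))
      (Real.exp ((Φ D c).eval t) * (derivative (Φ D c)).eval t) t :=
    (Real.hasDerivAt_exp _).comp t ((Φ D c).hasDerivAt t)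
  have h3 := h1.mul h2
  have e : G D c (m + 1) t = (derivative (Q D c m)).eval t * Real.exp ((Φ D c).eval t) +
      (Q D c m).eval t * (Real.exp ((Φ D c).eval t) * (derivative (Φ D c)).eval t) := by
    rw [G, Q_succ, eval_add, eval_mul]
    ring
  rw [e]
  exact h3

/-- `G_0(c; t) = exp(Φ_c(t))`. [folklore] -/
theorem G_zero (c : ℕ → ℝ) (t : ℝ) : G D c 0 t = Real.exp ((Φ D c).eval t) := by
  simp [G, Q]

/-- `Φ_c(t) = -t² + ∑_{3≤i≤D} cᵢ tⁱ`. [folklore] -/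
theorem eval_Φ (c : ℕ → ℝ) (t : ℝ) :
    (Φ D c).eval t = -t ^ 2 + ∑ i ∈ Icc 3 D, c i * t ^ i := by
  simp [Φ, eval_finsetSum]

/-- Degree bound `deg Φ_c ≤ D + 2`. [folklore] -/
theorem natDegree_Φ_le (c : ℕ → ℝ) : (Φ D c).natDegree ≤ D + 2 := by
  unfold Φ
  refine (natDegree_add_le _ _).trans (max_le ?_ ?_)
  · rw [natDegree_neg, natDegree_X_pow]; omega
  · refine (natDegree_sum_le_of_forall_le _ _ fun i hi => ?_)
    exact (natDegree_C_mul_X_pow_le _ _).trans (by have := (mem_Icc.1 hi).2; omega)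

/-- Degree bound `deg Q_m ≤ m (D + 2)`. [folklore] -/
theorem natDegree_Q_le (c : ℕ → ℝ) : ∀ m, (Q D c m).natDegree ≤ m * (D + 2)
  | 0 => by simp
  | m + 1 => by
    have ih := natDegree_Q_le c m
    have hΦ := natDegree_Φ_le D c
    rw [Q_succ]
    refine (natDegree_add_le _ _).trans (max_le ?_ ?_)
    · refine (natDegree_derivative_le _).trans ?_
      have : (Q D c m).natDegree - 1 ≤ (Q D c m).natDegree := Nat.sub_le _ _
      nlinarith
    · refine natDegree_mul_le.trans ?_
      have h1 := natDegree_derivative_le (Φ D c)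
      have h2 : (derivative (Φ D c)).natDegree ≤ D + 1 := by omega
      nlinarith

/-! ### Continuity of the coefficients of `Q_m(c)` in `c` -/

/-- The coefficients of `Φ_c`. [folklore] -/
theorem coeff_Φ (c : ℕ → ℝ) (r : ℕ) :
    (Φ D c).coeff r = (if r = 2 then -1 else 0) + if r ∈ Icc 3 D then c r else 0 := by
  simp only [Φ, coeff_add, coeff_neg, coeff_X_pow, finsetSum_coeff, coeff_C_mul]
  congr 1
  · split_ifs <;> simp
  · rw [Finset.sum_congr rfl fun i _ => by rw [mul_ite, mul_one, mul_zero]]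
    rw [Finset.sum_ite_eq]

variable {D}

section Limits

variable {cs : ℕ → ℕ → ℝ} {c : ℕ → ℝ}
  (hcs : ∀ i ∈ Icc 3 D, Tendsto (fun n => cs n i) atTop (𝓝 (c i)))
include hcs

/-- The coefficients of `Φ_{c(n)}` converge when `c(n)` does. [folklore] -/
theorem tendsto_coeff_Φ (r : ℕ) :
    Tendsto (fun n => (Φ D (cs n)).coeff r) atTop (𝓝 ((Φ D c).coeff r)) := by
  simp only [coeff_Φ]
  refine tendsto_const_nhds.add ?_
  split_ifs with h
  · exact hcs r h
  · exact tendsto_const_nhds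

/-- The coefficients of `Q_m(c(n))` converge when `c(n)` does (they are polynomials in `c`).
[folklore] -/
theorem tendsto_coeff_Q : ∀ (m r : ℕ),
    Tendsto (fun n => (Q D (cs n) m).coeff r) atTop (𝓝 ((Q D c m).coeff r))
  | 0, r => by simp [coeff_one]
  | m + 1, r => by
    simp only [Q_succ, coeff_add, coeff_derivative, coeff_mul]
    refine ((tendsto_coeff_Q m (r + 1)).mul tendsto_const_nhds).add ?_
    refine tendsto_finsetSum _ fun x _ => ?_
    exact (((tendsto_coeff_Φ hcs (x.1 + 1)).mul tendsto_const_nhds)).mul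
      (tendsto_coeff_Q m x.2)

omit hcs in
/-- Evaluation of a polynomial family with bounded degree and convergent coefficients at a
convergent point converges. [folklore] -/
theorem tendsto_eval_of_coeff {p : ℕ → ℝ[X]} {q : ℝ[X]} {B : ℕ} (hp : ∀ n, (p n).natDegree ≤ B)
    (hq : q.natDegree ≤ B) (hc : ∀ r, Tendsto (fun n => (p n).coeff r) atTop (𝓝 (q.coeff r)))
    {t : ℕ → ℝ} {t₀ : ℝ} (ht : Tendsto t atTop (𝓝 t₀)) :
    Tendsto (fun n => (p n).eval (t n)) atTop (𝓝 (q.eval t₀)) := by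
  have h1 : ∀ n, (p n).eval (t n) = ∑ i ∈ range (B + 1), (p n).coeff i * t n ^ i := fun n =>
    eval_eq_sum_range' (Nat.lt_succ_of_le (hp n)) _
  rw [eval_eq_sum_range' (Nat.lt_succ_of_le hq)]
  simp only [h1]
  exact tendsto_finsetSum _ fun i _ => (hc i).mul (ht.pow i)

/-- `Φ_{c(n)}(t(n)) → Φ_c(t₀)`. [folklore] -/
theorem tendsto_eval_Φ {t : ℕ → ℝ} {t₀ : ℝ} (ht : Tendsto t atTop (𝓝 t₀)) :
    Tendsto (fun n => (Φ D (cs n)).eval (t n)) atTop (𝓝 ((Φ D c).eval t₀)) :=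
  tendsto_eval_of_coeff (fun n => natDegree_Φ_le D (cs n)) (natDegree_Φ_le D c)
    (tendsto_coeff_Φ hcs) ht

/-- `Q_m(c(n))(t(n)) → Q_m(c)(t₀)`. [folklore] -/
theorem tendsto_eval_Q (m : ℕ) {t : ℕ → ℝ} {t₀ : ℝ} (ht : Tendsto t atTop (𝓝 t₀)) :
    Tendsto (fun n => (Q D (cs n) m).eval (t n)) atTop (𝓝 ((Q D c m).eval t₀)) :=
  tendsto_eval_of_coeff (fun n => natDegree_Q_le D (cs n) m) (natDegree_Q_le D c m)
    (tendsto_coeff_Q hcs m) ht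

/-- `G_m(c(n); t(n)) → G_m(c; t₀)` (joint continuity in parameters and point). [folklore] -/
theorem tendsto_G (m : ℕ) {t : ℕ → ℝ} {t₀ : ℝ} (ht : Tendsto t atTop (𝓝 t₀)) :
    Tendsto (fun n => G D (cs n) m (t n)) atTop (𝓝 (G D c m t₀)) :=
  (tendsto_eval_Q hcs m ht).mul ((Real.continuous_exp.tendsto _).comp (tendsto_eval_Φ hcs ht))

/-- **Normalised iterated differences converge to the derivative at `0`**: if the parameters
`c(n) → c` and the steps `0 < δ(n) → 0`, then `δ(n)^{-m} Δ_{δ(n)}^m [exp Φ_{c(n)}](0) →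
(exp Φ_c)^{(m)}(0)`. [folklore] -/
theorem tendsto_fwdDiff_iter_div_pow {δ : ℕ → ℝ} (hδpos : ∀ᶠ n in atTop, 0 < δ n)
    (hδ : Tendsto δ atTop (𝓝 0)) (m : ℕ) :
    Tendsto (fun n => Δ_[δ n]^[m] (G D (cs n) 0) 0 / δ n ^ m) atTop (𝓝 (G D c m 0)) := by
  classical
  -- the intermediate points
  have hex : ∀ n, 0 < δ n → ∃ ξ ∈ Set.Icc (0 : ℝ) (0 + m * δ n),
      Δ_[δ n]^[m] (G D (cs n) 0) 0 = δ n ^ m * G D (cs n) m ξ := fun n hn =>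
    exists_fwdDiff_iter_eq (G D (cs n)) (hasDerivAt_G D (cs n)) hn m 0
  set ξ : ℕ → ℝ := fun n => if hn : 0 < δ n then (hex n hn).choose else 0 with hξ
  have hξspec : ∀ n, 0 < δ n → ξ n ∈ Set.Icc (0 : ℝ) (m * δ n) ∧
      Δ_[δ n]^[m] (G D (cs n) 0) 0 = δ n ^ m * G D (cs n) m (ξ n) := by
    intro n hn
    have := (hex n hn).choose_spec
    simp only [hξ, dif_pos hn, zero_add] at this ⊢
    exact this
  -- `ξ n → 0`
  have hξ0 : Tendsto ξ atTop (𝓝 0) := by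
    have hup : Tendsto (fun n => (m : ℝ) * δ n) atTop (𝓝 0) := by
      simpa using hδ.const_mul (m : ℝ)
    refine tendsto_of_tendsto_of_tendsto_of_le_of_le' tendsto_const_nhds hup ?_ ?_
    · filter_upwards [hδpos] with n hn using (hξspec n hn).1.1
    · filter_upwards [hδpos] with n hn using (hξspec n hn).1.2
  refine (tendsto_G hcs m hξ0).congr' ?_
  filter_upwards [hδpos] with n hn
  rw [(hξspec n hn).2, mul_div_cancel_left₀ _ (pow_ne_zero _ hn.ne')]

end Limits

/-! ### Hankel determinants and iterated differences -/

section Hankel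

variable (ν : ℕ)

/-- The `ν × ν` Hankel matrix `(f(l + j))_{l,j<ν}` of `f : ℕ → ℝ`. [folklore] -/
def hankel (f : ℕ → ℝ) : Matrix (Fin ν) (Fin ν) ℝ := Matrix.of fun l j => f ((l : ℕ) + j)

/-- The unitriangular matrix of signed binomial coefficients `((-1)^{l-i} C(l,i))_{l,i}`, which
implements iterated forward differences. [folklore] -/
def diffLower : Matrix (Fin ν) (Fin ν) ℝ :=
  Matrix.of fun l i => (-1 : ℝ) ^ ((l : ℕ) - i) * ((l : ℕ).choose i : ℝ)

/-- `det diffLower = 1` (lower unitriangular). [folklore] -/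
theorem det_diffLower : (diffLower ν).det = 1 := by
  rw [Matrix.det_of_lowerTriangular (diffLower ν)]
  · simp [diffLower]
  · intro i j hij
    have hij' : (i : ℕ) < j := hij
    simp [diffLower, Nat.choose_eq_zero_of_lt hij']

/-- The iterated unit-step forward difference as a sum over `Fin ν`. [folklore] -/
theorem fwdDiff_iter_eq_sum_fin (f : ℕ → ℝ) {n : ℕ} (hn : n < ν) (y : ℕ) :
    Δ_[1]^[n] f y = ∑ k : Fin ν, ((-1 : ℝ) ^ (n - k) * (n.choose k : ℝ)) * f (y + k) := by
  rw [fwdDiff_iter_eq_sum_shift]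
  have e : ∀ k : ℕ, ((-1 : ℤ) ^ (n - k) * n.choose k) • f (y + k • 1) =
      ((-1 : ℝ) ^ (n - k) * (n.choose k : ℝ)) * f (y + k) := by
    intro k
    rw [zsmul_eq_mul, smul_eq_mul, mul_one]
    push_cast
    ring
  simp only [e]
  rw [Fin.sum_univ_eq_sum_range (fun k => ((-1 : ℝ) ^ (n - k) * (n.choose k : ℝ)) * f (y + k)) ν]
  refine Finset.sum_subset (fun k hk => ?_) fun k _ hk' => ?_
  · simp only [mem_range] at hk ⊢; omega
  · have : n < k := by simp only [mem_range, not_lt] at hk'; omega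
    rw [Nat.choose_eq_zero_of_lt this]
    simp

/-- `T · Hankel(f) · Tᵀ = (Δ^{l+j} f(0))_{l,j}` for the difference matrix `T`. [folklore] -/
theorem diffLower_mul_hankel_mul_transpose (f : ℕ → ℝ) (l j : Fin ν) :
    (diffLower ν * hankel ν f * (diffLower ν)ᵀ) l j = Δ_[1]^[(l : ℕ) + j] f 0 := by
  rw [Function.iterate_add_apply, fwdDiff_iter_eq_sum_fin ν _ l.2 0]
  simp only [Matrix.mul_apply, Matrix.transpose_apply, diffLower, hankel, Matrix.of_apply,
    zero_add, Finset.sum_mul]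
  rw [Finset.sum_comm]
  refine Finset.sum_congr rfl fun i _ => ?_
  rw [fwdDiff_iter_eq_sum_fin ν f j.2 i, Finset.mul_sum]
  refine Finset.sum_congr rfl fun i' _ => ?_
  ring

/-- **The Hankel determinant is the determinant of the table of iterated differences**
`(Δ^{l+j} f(0))_{l,j<ν}` (row and column difference operations are unitriangular). [folklore] -/
theorem det_hankel_eq_det_fwdDiff (f : ℕ → ℝ) :
    (hankel ν f).det = (Matrix.of fun l j : Fin ν => Δ_[1]^[(l : ℕ) + j] f 0).det := by
  have : Matrix.of (fun l j : Fin ν => Δ_[1]^[(l : ℕ) + j] f 0) =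
      diffLower ν * hankel ν f * (diffLower ν)ᵀ := by
    ext l j
    rw [Matrix.of_apply, diffLower_mul_hankel_mul_transpose]
  rw [this, Matrix.det_mul, Matrix.det_mul, Matrix.det_transpose, det_diffLower]
  ring

/-- Pulling `δ^l` out of row `l` and `δ^j` out of column `j`. [folklore] -/
theorem det_of_pow_add_mul (δ : ℝ) (N : Matrix (Fin ν) (Fin ν) ℝ) :
    (Matrix.of fun l j : Fin ν => δ ^ ((l : ℕ) + j) * N l j).det =
      (∏ i : Fin ν, δ ^ (i : ℕ)) ^ 2 * N.det := by
  have h1 : Matrix.of (fun l j : Fin ν => δ ^ ((l : ℕ) + j) * N l j) =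
      Matrix.of fun l j : Fin ν => δ ^ (l : ℕ) *
        (Matrix.of fun l' j' : Fin ν => δ ^ (j' : ℕ) * N l' j') l j := by
    ext l j
    simp only [Matrix.of_apply, pow_add]
    ring
  rw [h1, Matrix.det_mul_column, Matrix.det_mul_row]
  ring

end Hankel

/-! ### The Gaussian comparison matrix: an explicit Vandermonde lower bound -/

section Gauss

/-- `a - b ≤ exp a - exp b` for `0 ≤ b ≤ a`. [folklore] -/
theorem sub_le_exp_sub_exp {a b : ℝ} (hab : b ≤ a) (hb : 0 ≤ b) :
    a - b ≤ Real.exp a - Real.exp b := by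
  have h1 : Real.exp b * (a - b) ≤ Real.exp b * (Real.exp (a - b) - 1) := by
    apply mul_le_mul_of_nonneg_left _ (Real.exp_pos b).le
    linarith [Real.add_one_le_exp (a - b)]
  have h2 : (a - b) ≤ Real.exp b * (a - b) := by
    have := Real.one_le_exp hb
    nlinarith
  calc a - b ≤ Real.exp b * (a - b) := h2
    _ ≤ Real.exp b * (Real.exp (a - b) - 1) := h1
    _ = Real.exp a - Real.exp b := by
      rw [mul_sub, ← Real.exp_add, mul_one]
      congr 2
      ring

variable (ν : ℕ)

/-- The Gaussian matrix `(exp(-δ²(y_j - l)²))_{l,j}` factors through a Vandermonde matrix: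
its determinant is `∏ₗ e^{-δ²l²} ∏ⱼ e^{-δ²yⱼ²} ∏_{i<j} (e^{2δ²yⱼ} - e^{2δ²yᵢ})`. (The classical
strict total positivity of the Gaussian kernel on increasing nodes.) [folklore] -/
theorem det_gauss_eq (δ : ℝ) (y : Fin ν → ℝ) :
    (Matrix.of fun l j : Fin ν => Real.exp (-(δ ^ 2 * (y j - l) ^ 2))).det =
      (∏ l : Fin ν, Real.exp (-(δ ^ 2 * (l : ℝ) ^ 2))) *
        ((∏ j : Fin ν, Real.exp (-(δ ^ 2 * y j ^ 2))) *
          ∏ i : Fin ν, ∏ j ∈ Ioi i, (Real.exp (2 * δ ^ 2 * y j) - Real.exp (2 * δ ^ 2 * y i))) := by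
  have h : Matrix.of (fun l j : Fin ν => Real.exp (-(δ ^ 2 * (y j - l) ^ 2))) =
      Matrix.of fun l j : Fin ν => Real.exp (-(δ ^ 2 * (l : ℝ) ^ 2)) *
        (Matrix.of fun l' j' : Fin ν => Real.exp (-(δ ^ 2 * y j' ^ 2)) *
          (Matrix.vandermonde (fun j => Real.exp (2 * δ ^ 2 * y j)))ᵀ l' j') l j := by
    ext l j
    simp only [Matrix.of_apply, Matrix.transpose_apply, Matrix.vandermonde_apply]
    rw [← Real.exp_nat_mul, ← Real.exp_add, ← Real.exp_add]
    congr 1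
    ring
  rw [h, Matrix.det_mul_column, Matrix.det_mul_row, Matrix.det_transpose,
    Matrix.det_vandermonde]

/-- `∑_{i<ν} #{j : i < j < ν} = ∑_{i<ν} i`. [folklore] -/
theorem sum_card_Ioi_fin : ∑ i : Fin ν, (Ioi i).card = ∑ i : Fin ν, (i : ℕ) := by
  simp only [Fin.card_Ioi]
  rw [Fin.sum_univ_eq_sum_range (fun i => ν - 1 - i) ν, Fin.sum_univ_eq_sum_range (fun i => i) ν]
  exact Finset.sum_range_reflect (fun i => i) ν

/-- **Lower bound for the Gaussian determinant** on the nodes `l` and `y_j = j + ν - 1`: for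
`0 < δ ≤ 1`, `det ≥ e^{-5ν³} (2δ²)^{∑_{i<ν} i}`. [folklore] -/
theorem gauss_det_lower_bound {δ : ℝ} (hδ0 : 0 < δ) (hδ1 : δ ≤ 1) :
    Real.exp (-(ν : ℝ) ^ 3) * Real.exp (-(4 * (ν : ℝ) ^ 3)) *
        (2 * δ ^ 2) ^ (∑ i : Fin ν, (i : ℕ)) ≤
      (Matrix.of fun l j : Fin ν =>
        Real.exp (-(δ ^ 2 * (((j : ℕ) + (ν - 1 : ℕ) : ℝ) - l) ^ 2))).det := by
  rw [det_gauss_eq]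
  have hδ2 : δ ^ 2 ≤ 1 := by nlinarith
  have hν : ∀ l : Fin ν, (l : ℝ) < ν := fun l => by exact_mod_cast l.2
  -- factor 1
  have F1 : Real.exp (-(ν : ℝ) ^ 3) ≤ ∏ l : Fin ν, Real.exp (-(δ ^ 2 * (l : ℝ) ^ 2)) := by
    have : Real.exp (-(ν : ℝ) ^ 3) = ∏ _l : Fin ν, Real.exp (-(ν : ℝ) ^ 2) := by
      rw [Finset.prod_const, Finset.card_univ, Fintype.card_fin, ← Real.exp_nat_mul]
      congr 1; ring
    rw [this]
    refine Finset.prod_le_prod (fun l _ => (Real.exp_pos _).le) fun l _ => ?_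
    refine Real.exp_le_exp.2 (neg_le_neg ?_)
    have h1 : (l : ℝ) ^ 2 ≤ (ν : ℝ) ^ 2 := by
      have := hν l; have h0 : (0 : ℝ) ≤ l := Nat.cast_nonneg _; nlinarith
    calc δ ^ 2 * (l : ℝ) ^ 2 ≤ 1 * (ν : ℝ) ^ 2 :=
          mul_le_mul hδ2 h1 (sq_nonneg _) zero_le_one
      _ = (ν : ℝ) ^ 2 := one_mul _
  -- factor 2
  have F2 : Real.exp (-(4 * (ν : ℝ) ^ 3)) ≤
      ∏ j : Fin ν, Real.exp (-(δ ^ 2 * (((j : ℕ) + (ν - 1 : ℕ) : ℝ)) ^ 2)) := by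
    have : Real.exp (-(4 * (ν : ℝ) ^ 3)) = ∏ _l : Fin ν, Real.exp (-(4 * (ν : ℝ) ^ 2)) := by
      rw [Finset.prod_const, Finset.card_univ, Fintype.card_fin, ← Real.exp_nat_mul]
      congr 1; ring
    rw [this]
    refine Finset.prod_le_prod (fun l _ => (Real.exp_pos _).le) fun j _ => ?_
    refine Real.exp_le_exp.2 (neg_le_neg ?_)
    have hj := hν j
    have hν1 : ((ν - 1 : ℕ) : ℝ) ≤ ν := by exact_mod_cast Nat.sub_le ν 1
    have h0 : (0 : ℝ) ≤ (j : ℕ) + ((ν - 1 : ℕ) : ℝ) := by positivity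
    have h1 : ((j : ℕ) + ((ν - 1 : ℕ) : ℝ)) ^ 2 ≤ 4 * (ν : ℝ) ^ 2 := by
      have : (j : ℕ) + ((ν - 1 : ℕ) : ℝ) ≤ 2 * ν := by linarith
      nlinarith
    calc δ ^ 2 * ((j : ℕ) + ((ν - 1 : ℕ) : ℝ)) ^ 2 ≤ 1 * (4 * (ν : ℝ) ^ 2) :=
          mul_le_mul hδ2 h1 (sq_nonneg _) zero_le_one
      _ = 4 * (ν : ℝ) ^ 2 := one_mul _
  -- factor 3
  have F3 : (2 * δ ^ 2) ^ (∑ i : Fin ν, (i : ℕ)) ≤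
      ∏ i : Fin ν, ∏ j ∈ Ioi i, (Real.exp (2 * δ ^ 2 * ((j : ℕ) + ((ν - 1 : ℕ) : ℝ))) -
        Real.exp (2 * δ ^ 2 * ((i : ℕ) + ((ν - 1 : ℕ) : ℝ)))) := by
    rw [← sum_card_Ioi_fin, ← Finset.prod_pow_eq_pow_sum]
    refine Finset.prod_le_prod (fun i _ => by positivity) fun i _ => ?_
    rw [← Finset.prod_const]
    refine Finset.prod_le_prod (fun j _ => by positivity) fun j hj => ?_
    have hij : (i : ℕ) + 1 ≤ j := by
      have : i < j := Finset.mem_Ioi.1 hj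
      exact this
    have hij' : (i : ℝ) + 1 ≤ j := by exact_mod_cast hij
    refine le_trans ?_ (sub_le_exp_sub_exp ?_ ?_)
    · nlinarith [sq_nonneg δ]
    · have : (i : ℝ) ≤ j := by linarith
      have hδ' : 0 ≤ 2 * δ ^ 2 := by positivity
      nlinarith
    · positivity
  have P3 : 0 ≤ (2 * δ ^ 2) ^ (∑ i : Fin ν, (i : ℕ)) := by positivity
  calc Real.exp (-(ν : ℝ) ^ 3) * Real.exp (-(4 * (ν : ℝ) ^ 3)) * (2 * δ ^ 2) ^ (∑ i : Fin ν, (i : ℕ))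
      = Real.exp (-(ν : ℝ) ^ 3) * (Real.exp (-(4 * (ν : ℝ) ^ 3)) *
          (2 * δ ^ 2) ^ (∑ i : Fin ν, (i : ℕ))) := by ring
    _ ≤ _ := by
      refine mul_le_mul F1 (mul_le_mul F2 F3 P3 ?_) (by positivity) ?_
      · exact Finset.prod_nonneg fun _ _ => (Real.exp_pos _).le
      · exact Finset.prod_nonneg fun _ _ => (Real.exp_pos _).le

end Gauss

/-! ### Assembly -/

section Main

/-- Unit-step differences of `s ↦ f(δ s)` on `ℕ` are `δ`-step differences of `f` on `ℝ`.
[folklore] -/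
theorem fwdDiff_iter_natScale (f : ℝ → ℝ) (δ : ℝ) (m : ℕ) :
    Δ_[1]^[m] (fun s : ℕ => f (δ * s)) 0 = Δ_[δ]^[m] f 0 := by
  rw [fwdDiff_iter_eq_sum_shift, fwdDiff_iter_eq_sum_shift]
  refine Finset.sum_congr rfl fun k _ => ?_
  simp only [zero_add, smul_eq_mul, mul_one, nsmul_eq_mul]
  rw [mul_comm (k : ℝ) δ]

/-- `(eˣ⁽ⁿ⁾ - 1) = o(δ(n)^m)` when `x = o(δ^D)`, `m ≤ D` and `δ → 0`. [folklore] -/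
theorem isLittleO_exp_sub_one {x δ : ℕ → ℝ} {m D : ℕ} (hmD : m ≤ D)
    (hδ : Tendsto δ atTop (𝓝 0)) (hx : x =o[atTop] fun n => δ n ^ D) :
    (fun n => Real.exp (x n) - 1) =o[atTop] fun n => δ n ^ m := by
  -- `x → 0`
  have hx0 : Tendsto x atTop (𝓝 0) := by
    rcases Nat.eq_zero_or_pos D with rfl | hD
    · simpa using hx.tendsto_div_nhds_zero
    · exact hx.trans_tendsto (by simpa [hD.ne'] using hδ.pow D)
  have h1 : (fun n => Real.exp (x n) - 1) =O[atTop] x := by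
    refine IsBigO.of_bound 2 ?_
    filter_upwards [hx0.eventually (Metric.closedBall_mem_nhds (0 : ℝ) one_pos)] with n hn
    have : |x n| ≤ 1 := by simpa [Real.dist_eq] using hn
    simpa [Real.norm_eq_abs] using Real.abs_exp_sub_one_le this
  have h2 : (fun n => δ n ^ D) =O[atTop] fun n => δ n ^ m := by
    refine IsBigO.of_bound 1 ?_
    filter_upwards [hδ.eventually (Metric.closedBall_mem_nhds (0 : ℝ) one_pos)] with n hn
    have hn' : |δ n| ≤ 1 := by simpa [Real.dist_eq] using hn
    rw [Real.norm_eq_abs, Real.norm_eq_abs, one_mul, abs_pow, abs_pow]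
    exact pow_le_pow_of_le_one (abs_nonneg _) hn' hmD
  exact (h1.trans_isLittleO hx).trans_isBigO h2

/-- **Main theorem (E1).** Let `a > 0` be a sequence admitting, for some `D ≥ 2ν - 2`, a
Hermite-type expansion `log(a(n+j)/a(n)) = A(n) j - δ(n)² j² + ∑_{i=3}^{D} gᵢ(n) jⁱ + o(δ(n)^D)`
(`0 ≤ j ≤ D`) with `0 < δ(n) → 0` and `gᵢ(n) = o(δ(n)ⁱ)` [the shape of GORZ 2019, §5.1 eq. (15)].
Then the consecutive Toeplitz minors `det (a_{k+j-l})_{l,j<ν}` are positive for all large `k`.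
Proof: Hankel form via row reversal, exact factorisation `a(n+s) = a(n) e^{A s} F̂(s)`,
difference table `det Hankel(F̂) = δ^{ν(ν-1)} det N` with `N → (He-type constants)`, and
comparison with the Gaussian `e^{-δ²s²}` whose matrix is a positive Vandermonde-type determinant
`≥ e^{-5ν³}(2δ²)^{ν(ν-1)/2}`. [folklore] -/
theorem det_toeplitz_eventually_pos {a : ℕ → ℝ} (ha : ∀ n, 0 < a n) {ν D : ℕ}
    (hD : 2 * ν ≤ D + 2) {A δ : ℕ → ℝ} {g : ℕ → ℕ → ℝ}
    (hδpos : ∀ᶠ n in atTop, 0 < δ n) (hδ : Tendsto δ atTop (𝓝 0))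
    (hg : ∀ i, 3 ≤ i → i ≤ D → (g i) =o[atTop] fun n => δ n ^ i)
    (hlog : ∀ j : ℕ, j ≤ D → (fun n => Real.log (a (n + j) / a n) -
        (A n * j - δ n ^ 2 * (j : ℝ) ^ 2 + ∑ i ∈ Icc 3 D, g i n * (j : ℝ) ^ i)) =o[atTop]
        fun n => δ n ^ D) :
    ∃ N : ℕ, ∀ k : ℕ, N ≤ k → 0 < (Matrix.of fun l j : Fin ν => a (k + j - l)).det := by
  classical
  rcases Nat.eq_zero_or_pos ν with rfl | hν
  · exact ⟨0, fun k _ => by simp [Matrix.det_isEmpty]⟩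
  -- the objects
  set cs : ℕ → ℕ → ℝ := fun n i => g i n / δ n ^ i with hcs_def
  set ε : ℕ → ℕ → ℝ := fun n s => Real.log (a (n + s) / a n) -
    (A n * s - δ n ^ 2 * (s : ℝ) ^ 2 + ∑ i ∈ Icc 3 D, g i n * (s : ℝ) ^ i) with hε_def
  set Fh : ℕ → ℕ → ℝ := fun n s => a (n + s) / (a n * Real.exp (A n * s)) with hFh_def
  set F : ℕ → ℕ → ℝ := fun n s => G D (cs n) 0 (δ n * s) with hF_def
  set F0 : ℕ → ℕ → ℝ := fun n s => G D (fun _ => 0) 0 (δ n * s) with hF0_def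
  set H : ℕ → ℝ := fun m => G D (fun _ => 0) m 0 with hH_def
  set Hmat : Matrix (Fin ν) (Fin ν) ℝ := Matrix.of fun l j => H ((l : ℕ) + j) with hHmat
  set Nh : ℕ → Matrix (Fin ν) (Fin ν) ℝ :=
    fun n => Matrix.of fun l j => Δ_[1]^[(l : ℕ) + j] (Fh n) 0 / δ n ^ ((l : ℕ) + j) with hNh
  set N0 : ℕ → Matrix (Fin ν) (Fin ν) ℝ :=
    fun n => Matrix.of fun l j => Δ_[1]^[(l : ℕ) + j] (F0 n) 0 / δ n ^ ((l : ℕ) + j) with hN0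
  -- (1) the parameters tend to `0`
  have hcs : ∀ i ∈ Icc 3 D, Tendsto (fun n => cs n i) atTop (𝓝 ((fun _ => (0 : ℝ)) i)) := by
    intro i hi
    exact (hg i (mem_Icc.1 hi).1 (mem_Icc.1 hi).2).tendsto_div_nhds_zero
  have hcs0 : ∀ i ∈ Icc 3 D, Tendsto (fun _ : ℕ => (fun _ => (0 : ℝ)) i) atTop
      (𝓝 ((fun _ => (0 : ℝ)) i)) := fun i _ => tendsto_const_nhds
  -- (2) `F̂ = F · e^{ε}` when `δ ≠ 0`
  have hFhF : ∀ n, δ n ≠ 0 → ∀ s : ℕ, Fh n s = F n s * Real.exp (ε n s) := by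
    intro n hn s
    have hP : (Φ D (cs n)).eval (δ n * s) = -(δ n ^ 2 * (s : ℝ) ^ 2) +
        ∑ i ∈ Icc 3 D, g i n * (s : ℝ) ^ i := by
      rw [eval_Φ]
      congr 1
      · ring
      · refine Finset.sum_congr rfl fun i _ => ?_
        simp only [hcs_def, mul_pow]
        field_simp
    simp only [hFh_def, hF_def, G_zero, hε_def]
    rw [← Real.exp_add, hP]
    have e1 : -(δ n ^ 2 * (s : ℝ) ^ 2) + ∑ i ∈ Icc 3 D, g i n * (s : ℝ) ^ i +
        (Real.log (a (n + s) / a n) -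
          (A n * s - δ n ^ 2 * (s : ℝ) ^ 2 + ∑ i ∈ Icc 3 D, g i n * (s : ℝ) ^ i)) =
        Real.log (a (n + s) / a n) + -(A n * s) := by ring
    rw [e1, Real.exp_add, Real.exp_log (div_pos (ha _) (ha _)), Real.exp_neg]
    have h0 : a n ≠ 0 := (ha n).ne'
    have h1 : Real.exp (A n * s) ≠ 0 := (Real.exp_pos _).ne'
    field_simp
  -- (3) entrywise limits of the difference tables
  have hN0lim : ∀ m : ℕ, Tendsto (fun n => Δ_[1]^[m] (F0 n) 0 / δ n ^ m) atTop (𝓝 (H m)) := by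
    intro m
    have := tendsto_fwdDiff_iter_div_pow (D := D) hcs0 hδpos hδ m
    refine this.congr' (Eventually.of_forall fun n => ?_)
    simp only [hF0_def]
    rw [fwdDiff_iter_natScale]
  have hNhlim : ∀ m : ℕ, m ≤ D →
      Tendsto (fun n => Δ_[1]^[m] (Fh n) 0 / δ n ^ m) atTop (𝓝 (H m)) := by
    intro m hm
    -- main part
    have hmain : Tendsto (fun n => Δ_[1]^[m] (F n) 0 / δ n ^ m) atTop (𝓝 (H m)) := by
      have := tendsto_fwdDiff_iter_div_pow (D := D) hcs hδpos hδ m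
      refine this.congr' (Eventually.of_forall fun n => ?_)
      simp only [hF_def]
      rw [fwdDiff_iter_natScale]
    -- error part
    have herr : Tendsto (fun n => (Δ_[1]^[m] (Fh n) 0 - Δ_[1]^[m] (F n) 0) / δ n ^ m) atTop
        (𝓝 0) := by
      have e : ∀ n, δ n ≠ 0 → (Δ_[1]^[m] (Fh n) 0 - Δ_[1]^[m] (F n) 0) / δ n ^ m =
          ∑ k : Fin (m + 1), ((-1 : ℝ) ^ (m - k) * (m.choose k : ℝ)) *
            (F n k * ((Real.exp (ε n k) - 1) / δ n ^ m)) := by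
        intro n hn
        rw [fwdDiff_iter_eq_sum_fin (m + 1) (Fh n) (Nat.lt_succ_self m) 0,
          fwdDiff_iter_eq_sum_fin (m + 1) (F n) (Nat.lt_succ_self m) 0, ← Finset.sum_sub_distrib,
          div_eq_mul_inv, Finset.sum_mul]
        refine Finset.sum_congr rfl fun k _ => ?_
        rw [zero_add, hFhF n hn k]
        ring
      have hlim : Tendsto (fun n => ∑ k : Fin (m + 1), ((-1 : ℝ) ^ (m - k) * (m.choose k : ℝ)) *
          (F n k * ((Real.exp (ε n k) - 1) / δ n ^ m))) atTop (𝓝 0) := by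
        rw [show (0 : ℝ) = ∑ k : Fin (m + 1), ((-1 : ℝ) ^ (m - k) * (m.choose k : ℝ)) *
          (G D (fun _ => (0 : ℝ)) 0 0 * 0) by simp]
        refine tendsto_finsetSum _ fun k _ => tendsto_const_nhds.mul (Tendsto.mul ?_ ?_)
        · simp only [hF_def]
          refine tendsto_G hcs 0 ?_
          simpa using hδ.mul_const (k : ℝ)
        · have hk : (k : ℕ) ≤ D := by have := k.2; omega
          have := isLittleO_exp_sub_one hm hδ (hlog k hk)
          exact this.tendsto_div_nhds_zero
      refine hlim.congr' ?_
      filter_upwards [hδpos] with n hn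
      rw [e n hn.ne']
    have := hmain.add herr
    rw [add_zero] at this
    refine this.congr' (Eventually.of_forall fun n => ?_)
    ring
  -- (4) the matrices `Nh`, `N0` converge to `Hmat`, hence `det Nh - det N0 → 0`
  have hmat : ∀ (M : ℕ → Matrix (Fin ν) (Fin ν) ℝ),
      (∀ l j : Fin ν, Tendsto (fun n => M n l j) atTop (𝓝 (Hmat l j))) →
        Tendsto (fun n => (M n).det) atTop (𝓝 Hmat.det) := by
    intro M hM
    have h1 : Tendsto M atTop (𝓝 Hmat) :=
      tendsto_pi_nhds.2 fun l => tendsto_pi_nhds.2 fun j => hM l j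
    exact ((continuous_id.matrix_det).tendsto Hmat).comp h1
  have hdetNh : Tendsto (fun n => (Nh n).det) atTop (𝓝 Hmat.det) := by
    refine hmat Nh fun l j => ?_
    simp only [hNh, hHmat, Matrix.of_apply]
    exact hNhlim _ (by have := l.2; have := j.2; omega)
  have hdetN0 : Tendsto (fun n => (N0 n).det) atTop (𝓝 Hmat.det) := by
    refine hmat N0 fun l j => ?_
    simp only [hN0, hHmat, Matrix.of_apply]
    exact hN0lim _
  have hdiff : Tendsto (fun n => (Nh n).det - (N0 n).det) atTop (𝓝 0) := by
    have := hdetNh.sub hdetN0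
    rwa [sub_self] at this
  -- (5) the constants
  set e : ℕ := ∑ i : Fin ν, (i : ℕ) with he_def
  set κ : ℝ := Real.exp (-(ν : ℝ) ^ 3) * Real.exp (-(4 * (ν : ℝ) ^ 3)) with hκ_def
  have hκ : 0 < κ := by positivity
  -- (6) choose `N`
  have hev : ∀ᶠ n in atTop, 0 < δ n ∧ δ n ≤ 1 ∧ |(Nh n).det - (N0 n).det| < κ * 2 ^ e := by
    refine (hδpos.and ((hδ.eventually (Metric.closedBall_mem_nhds (0 : ℝ) one_pos)).and
      (hdiff.eventually (Metric.ball_mem_nhds (0 : ℝ)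
        (show (0 : ℝ) < κ * 2 ^ e by positivity))))).mono ?_
    rintro n ⟨h1, h2, h3⟩
    refine ⟨h1, ?_, ?_⟩
    · have : |δ n| ≤ 1 := by simpa [Real.dist_eq] using h2
      exact (le_abs_self _).trans this
    · simpa [Real.dist_eq] using h3
  obtain ⟨N₁, hN₁⟩ := Filter.eventually_atTop.1 hev
  refine ⟨N₁ + (ν - 1), fun k hk => ?_⟩
  set n := k - (ν - 1) with hn_def
  obtain ⟨hδn, hδ1, hclose⟩ := hN₁ n (by omega)
  -- (7) row reversal: Hankel form
  set σ : Equiv.Perm (Fin ν) := Fin.revPerm with hσ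
  set E : Matrix (Fin ν) (Fin ν) ℝ := Matrix.of fun l j : Fin ν => a (k + j - l) with hE
  have hsign : ((Equiv.Perm.sign σ : ℤ) : ℝ) * ((Equiv.Perm.sign σ : ℤ) : ℝ) = 1 := by
    rw [← Int.cast_mul, ← Units.val_mul, Int.units_mul_self]
    simp
  have hErev : E.submatrix σ id = Matrix.of fun l j : Fin ν =>
      (a n * Real.exp (A n * l)) *
        (Matrix.of fun l' j' : Fin ν => Real.exp (A n * j') * hankel ν (Fh n) l' j') l j := by
    ext l j
    simp only [hE, Matrix.submatrix_apply, Matrix.of_apply, id, hσ, Fin.revPerm_apply,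
      hankel, hFh_def, Fin.val_rev]
    have hidx : k + (j : ℕ) - (ν - ((l : ℕ) + 1)) = n + ((l : ℕ) + j) := by
      have := l.2; omega
    rw [hidx]
    have h0 : a n ≠ 0 := (ha n).ne'
    have h1 : Real.exp (A n * l) ≠ 0 := (Real.exp_pos _).ne'
    have h2 : Real.exp (A n * j) ≠ 0 := (Real.exp_pos _).ne'
    push_cast
    rw [mul_add, Real.exp_add]
    field_simp
  have hdetE : E.det = ((Equiv.Perm.sign σ : ℤ) : ℝ) *
      (((∏ l : Fin ν, a n * Real.exp (A n * l)) * ∏ j : Fin ν, Real.exp (A n * j)) *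
        (hankel ν (Fh n)).det) := by
    have h1 := Matrix.det_permute σ E
    rw [hErev, Matrix.det_mul_column, Matrix.det_mul_row] at h1
    have h2 : E.det = ((Equiv.Perm.sign σ : ℤ) : ℝ) * (((Equiv.Perm.sign σ : ℤ) : ℝ) * E.det) := by
      rw [← mul_assoc, hsign, one_mul]
    rw [h2, ← h1]
    ring
  -- (8) the Gaussian matrix in Hankel form
  set M0 : Matrix (Fin ν) (Fin ν) ℝ := Matrix.of fun l j : Fin ν =>
    Real.exp (-(δ n ^ 2 * (((j : ℕ) + (ν - 1 : ℕ) : ℝ) - l) ^ 2)) with hM0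
  have hM0rev : M0.submatrix σ id = hankel ν (F0 n) := by
    ext l j
    simp only [hM0, Matrix.submatrix_apply, Matrix.of_apply, id, hσ, Fin.revPerm_apply,
      hankel, hF0_def, Fin.val_rev, G_zero, eval_Φ, Finset.sum_const_zero, zero_mul, add_zero]
    congr 1
    have : ((ν - ((l : ℕ) + 1) : ℕ) : ℝ) = (ν : ℝ) - 1 - l := by
      have := l.2
      rw [Nat.cast_sub (by omega)]
      push_cast
      ring
    rw [this]
    have : ((ν - 1 : ℕ) : ℝ) = (ν : ℝ) - 1 := by
      rw [Nat.cast_sub hν]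
      simp
    rw [this]
    push_cast
    ring
  have hdetM0 : ((Equiv.Perm.sign σ : ℤ) : ℝ) * (hankel ν (F0 n)).det = M0.det := by
    rw [← hM0rev, Matrix.det_permute, ← mul_assoc, hsign, one_mul]
  have hM0lb := gauss_det_lower_bound ν hδn hδ1
  -- (9) difference tables
  have hP : ∀ f : ℕ → ℝ, (hankel ν f).det =
      (∏ i : Fin ν, δ n ^ (i : ℕ)) ^ 2 *
        (Matrix.of fun l j : Fin ν => Δ_[1]^[(l : ℕ) + j] f 0 / δ n ^ ((l : ℕ) + j)).det := by
    intro f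
    rw [det_hankel_eq_det_fwdDiff, ← det_of_pow_add_mul]
    congr 1
    ext l j
    simp only [Matrix.of_apply]
    rw [mul_div_cancel₀ _ (pow_ne_zero _ hδn.ne')]
  have hPe : (∏ i : Fin ν, δ n ^ (i : ℕ)) ^ 2 = (δ n ^ 2) ^ e := by
    rw [Finset.prod_pow_eq_pow_sum, ← pow_mul, mul_comm, pow_mul]
  -- (10) the final estimate
  have key : 0 < ((Equiv.Perm.sign σ : ℤ) : ℝ) * (hankel ν (Fh n)).det := by
    have h1 : ((Equiv.Perm.sign σ : ℤ) : ℝ) * (hankel ν (Fh n)).det =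
        M0.det + ((Equiv.Perm.sign σ : ℤ) : ℝ) * ((δ n ^ 2) ^ e * ((Nh n).det - (N0 n).det)) := by
      rw [← hdetM0, hP (Fh n), hP (F0 n), hPe]
      simp only [hNh, hN0]
      ring
    rw [h1]
    have hs1 : |((Equiv.Perm.sign σ : ℤ) : ℝ)| = 1 := by
      rcases Int.units_eq_one_or (Equiv.Perm.sign σ) with h | h <;> simp [h]
    have h2 : |((Equiv.Perm.sign σ : ℤ) : ℝ) * ((δ n ^ 2) ^ e * ((Nh n).det - (N0 n).det))| <
        (δ n ^ 2) ^ e * (κ * 2 ^ e) := by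
      rw [abs_mul, hs1, one_mul, abs_mul, abs_of_pos (by positivity)]
      exact mul_lt_mul_of_pos_left hclose (by positivity)
    have h3 : (δ n ^ 2) ^ e * (κ * 2 ^ e) ≤ M0.det := by
      refine le_trans (le_of_eq ?_) hM0lb
      rw [hκ_def, mul_pow]
      ring
    have h4 := neg_abs_le (((Equiv.Perm.sign σ : ℤ) : ℝ) *
      ((δ n ^ 2) ^ e * ((Nh n).det - (N0 n).det)))
    linarith
  rw [hdetE]
  have hR : 0 < (∏ l : Fin ν, a n * Real.exp (A n * l)) * ∏ j : Fin ν, Real.exp (A n * j) := by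
    refine mul_pos (Finset.prod_pos fun l _ => mul_pos (ha n) (Real.exp_pos _))
      (Finset.prod_pos fun j _ => Real.exp_pos _)
  have : ((Equiv.Perm.sign σ : ℤ) : ℝ) *
      (((∏ l : Fin ν, a n * Real.exp (A n * l)) * ∏ j : Fin ν, Real.exp (A n * j)) *
        (hankel ν (Fh n)).det) =
      ((∏ l : Fin ν, a n * Real.exp (A n * l)) * ∏ j : Fin ν, Real.exp (A n * j)) *
        (((Equiv.Perm.sign σ : ℤ) : ℝ) * (hankel ν (Fh n)).det) := by ring
  rw [this]
  exact mul_pos hR key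

end Main

end ToeplitzAsymp

end Literature.Analysis.TotalPositivity
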